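/-
Copyright (c) 2026 the pub-hodgecm-mathlib formalisation cell (harness21).  Prover seat hodgecm-mathlib-F0P3a-p06 (g26), 2026-09-03.  E1 BRICK LEDGER row 56-B3(48) «TAME TWINS OF ★
48-DATUM» (E1 keeper ∕ dealer F0P3a-p03 (g30) deal 03:59:19Z; LEAD F0P3a-plan T15-42 (iii)); census `F0/P3a/F0P3a-p06/g26/b348/CENSUS-B3-48.v1.F0P3ap06g26.md`.  FILE 2 of 2 (THE HEAD).
-/
import Summits.HodgeConjecture.HodgeConjecture.Theorems.F0P3cStCharTSEPFunctionOrbitalOrbitsRamified   -- FILE 1-RAM of 2 (this seat): the four `hd`-reading facet-orbit heads re-issued `_of_involution` ∕ `_of_v_two` ∕ `_of_neg`; brings ★ 48 FILE 1 (PF heads), ★ 41g-H's letters, ★ R48-gen FILE 2, ★ FILE P §6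
import Literature.NumberTheory.Automorphic.UnitaryLatticeTreeStarOfInvolution                         -- ★ `not_isSelfDualLattice_of_isVertexLattice_two_of_v` (no vertex is both self-dual and of type two, place-free)
import HarnessLib

/-!
# Row 56-B3(48), FILE 2 of 2 — THE TAME TWIN of ★ 48-datum FILE 2 «THE HEAD»: the orbital integral of an Euler–Poincaré sum of `K`-type functions on `G_v = U(Φ₃)(L⁺_v)` at a regular
# elliptic class, unfolded over the `γ`-fixed vertices and edges of the Bruhat–Tits tree, WITHOUT the unramified datum ([SchneiderStuhler1997 §III.4], [Kottwitz1988 §2], [Rogawski1990 §4.9, §12.5])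

Cell `pub/hodgecm-mathlib` (D-0151), crux H413 = `stmt-HodgeConjecture-24833`; lane `--kind proof --supports stmt-HodgeConjecture-24833 --as helper` (THEOREMS ONLY: no definition ∕
instance ∕ notation ∕ named fact ∕ `sorry`; count-neutral: closes no node).  Namespace `Summit.HodgeConjecture.HodgeConjecture.Cruxes.H413.F0P3cStCharTSEPFunctionOrbitalEllipticRamified`.
Sibling of ★ `…F0P3cStCharTSEPFunctionOrbitalElliptic` (row 48 FILE 2, p853465) on ★ B3(53)'s pattern (p853453): the HEAD `classOrbitalIntegral_epSum_eq_fixedVertexSum_sub_fixedEdgeSum` re-issued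
`_of_involution` (place letters `hvσ hϖ` and the three orbit transitivities `htr₀ htr₂ htrE` hypothesis-style — ★ B3(53)'s ∕ FILE 1-RAM's spellings) and `_of_neg` (the seven TAME letters
`hσ hvσ hϖ hσϖ hres h2 hnorm` of ★ `isTree_latticeGraph_three_of_neg`, discharging `htr₀ htr₂ htrE` by ★ `exists_unitary_mapGL_stdLattice_eq_of_isSelfDualLattice_of_v_two`, ★
`forall_isVertexLattice_two_exists_mapGL_N₁_eq_of_neg`, FILE 1-RAM `exists_mapEdgeSet_eq_of_v_two`); every other binder (`hfin hfinE hreg hell`, `P₀ P₂ P₁`, `τ₀ τ₂ τ₁`, `f₀ f₂ f₁`, …) and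
the conclusion BYTE-IDENTICAL to ★ 48 FILE 2; the place letters sit exactly where `hd` sat (after `{ϖ}`, before `eA`).  Proof = ★ 48 FILE 2's, with ★ `type_of_lt_three` ∕ ★
`type_eq_zero_or_two_of_isVertexLattice_three` fed `hvσ hϖ`, (U4) by ★ FILE P §6 `latticeGraphIso_apply_eq_of_mem_unitaryLevel_of_adj_of_v` through `ha`, the three orbit terms by FILE 1-RAM's
`_of_involution` heads (+ ★ 48 FILE 1's place-free `classOrbitalIntegral_kType_vertex_eq` BY NAME), and ★ `not_isSelfDualLattice_of_isVertexLattice_two_of_v`.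
HONEST LABEL: count-neutral datum helper; TAME road GO-LOW (LEAD T15-42); WILD (dyadic) places stay PRINT (`h2 : |2| = 1` is a binder); (R-SS) NOT chartered; E1 = PRINT until the
keeper's charter test; h413 OPEN; HC_CM is proved only modulo the 7 printed citations (2 remaining named inputs hLiu418 = stmt-HodgeConjecture-24832, h413 = stmt-HodgeConjecture-24833)
until rung 0 closes; nothing printed is asserted here.

* THE HEAD **`classOrbitalIntegral_epSum_eq_fixedVertexSum_sub_fixedEdgeSum_of_involution`** (`hvσ hϖ htr₀ htr₂ htrE`) and **`…_of_neg`** (`hσ hvσ hϖ hσϖ hres h2 hnorm`):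
  `classOrbitalIntegral mQv ((ν P₀)⁻¹ • f₀ + (ν P₂)⁻¹ • f₂ − (ν P₁)⁻¹ • f₁) ⟦γ⟧ = (∑ x ∈ hfin.toFinset, ρ.levelTrace (hUo x) (hUc x) γ⁻¹) − ∑ d ∈ hfinE.toFinset, ρ.levelTrace (hEo d) (hEc d) γ⁻¹`.

## References
* [SchneiderStuhler1997] P. Schneider, U. Stuhler, *Representation theory and sheaves on the Bruhat–Tits building*, Publ. Math. IHÉS 85 (1997): §III.4.
* [Kottwitz1988] R. E. Kottwitz, *Tamagawa numbers*, Ann. of Math. 127 (1988): §2.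
* [Rogawski1990] J. D. Rogawski, *Automorphic Representations of Unitary Groups in Three Variables* (1990): §4.9 p. 54, §12.5 pp. 182–187.
* [BruhatTits1972] F. Bruhat, J. Tits, *Groupes réductifs sur un corps local* I, Publ. Math. IHÉS 41 (1972): §10.
-/

set_option autoImplicit false

set_option linter.dupNamespace false

noncomputable section

open NumberField IsDedekindDomain MeasureTheory Measure
open scoped Pointwise Valued WithZero Matrix MatrixGroups
open Literature.NumberTheory.Rogawski1990 Literature.NumberTheory.Rogawski1990.Ch12Sec5
open Literature.NumberTheory.Automorphic Literature.NumberTheory.Automorphic.UnitaryGroup Literature.NumberTheory.Automorphic.UnitaryLatticeTree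
open Literature.NumberTheory.Automorphic.HermitianLattice Literature.NumberTheory.GaloisRepresentations
open Literature.Combinatorics.SimpleGraph Literature.Combinatorics.SimpleGraph.OrientedIncidence

namespace Summit.HodgeConjecture.HodgeConjecture.Cruxes.H413.F0P3cStCharTSEPFunctionOrbitalEllipticRamified

open Summit.HodgeConjecture.HodgeConjecture.Cruxes.H413
open Summit.HodgeConjecture.HodgeConjecture.Cruxes.H413.F0P3cStCharTSCharacterEllipticUniform
open Summit.HodgeConjecture.HodgeConjecture.Cruxes.H413.F0P3cStCharTSEPFunctionOrbitalOrbits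
open Summit.HodgeConjecture.HodgeConjecture.Cruxes.H413.F0P3cStCharTSEPFunctionOrbitalOrbitsRamified

section Head

variable (L : Type) [Field L] [NumberField L] [IsCMField L] (v : HeightOneSpectrum (𝓞 ↥(maximalRealSubfield L)))

set_option maxHeartbeats 1600000 in
/-- **(SS-O) AT THE DATUM, place ∕ orbit letters hypothesis-style — the orbital integral of an Euler–Poincaré sum of `K`-type functions on the `U(Φ₃)(L⁺_v)` tree at a regular elliptic
class, unfolded over the `γ`-fixed vertices and edges** ([SchneiderStuhler1997 §III.4], [Kottwitz1988 §2]): ★ 48 FILE 2's HEAD with `hd` replaced by the place letters `|σ_w ·| = |·|`,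
`|ϖ| = q⁻¹` (`hvσ hϖ`) and the three facet-orbit transitivities `htr₀` (self-dual vertices are `u·L₀`), `htr₂` (type-two vertices are `u·N₁`), `htrE` (`G_v` moves edges to edges)
hypothesis-style; every other binder and the conclusion VERBATIM:
`Φ^{can}(γ, (ν P₀)⁻¹ f₀ + (ν P₂)⁻¹ f₂ − (ν P₁)⁻¹ f₁) = Σ_{x ∈ X^γ⁰} Θ_{U_x}(γ⁻¹) − Σ_{d ∈ X^γ¹} Θ_{U_d}(γ⁻¹)`.
[cite: SchneiderStuhler1997, §III.4] [cite: Kottwitz1988, §2 Theorem 2] [cite: Rogawski1990, §4.9 p. 54; §12.5 pp. 182–187] [cite: BruhatTits1972, §10] -/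
theorem classOrbitalIntegral_epSum_eq_fixedVertexSum_sub_fixedEdgeSum_of_involution
    (w : PlacesOver L v) (hw : IsCMField.complexConj L • w.1 = w.1) {ϖ : (w.1.adicCompletion L)}
    (hvσ : ∀ x, Valued.v ((galAdicCompletionMap (L := L) (IsCMField.complexConj L) hw) x) = Valued.v x) (hϖ : Valued.v ϖ = WithZero.exp (-1 : ℤ))
    (htr₀ : ∀ M : Submodule 𝒪[(w.1.adicCompletion L)] (Fin 3 → (w.1.adicCompletion L)), IsSelfDualLattice (galAdicCompletionMap (L := L) (IsCMField.complexConj L) hw) ϖ ((StdForm.antidiagonal 3).over (w.1.adicCompletion L)) M → ∃ u : ↥(unitaryGroupOfForm (galAdicCompletionMap (L := L) (IsCMField.complexConj L) hw) ((StdForm.antidiagonal 3).over (w.1.adicCompletion L))), M = mapGL (u : GL (Fin 3) (w.1.adicCompletion L)) (stdLattice (w.1.adicCompletion L) 3))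
    (htr₂ : ∀ M : Submodule 𝒪[(w.1.adicCompletion L)] (Fin 3 → (w.1.adicCompletion L)), IsVertexLattice (galAdicCompletionMap (L := L) (IsCMField.complexConj L) hw) ϖ ((StdForm.antidiagonal 3).over (w.1.adicCompletion L)) 2 M → ∃ u : ↥(unitaryGroupOfForm (galAdicCompletionMap (L := L) (IsCMField.complexConj L) hw) ((StdForm.antidiagonal 3).over (w.1.adicCompletion L))), M = mapGL (u : GL (Fin 3) (w.1.adicCompletion L)) (latt (Matrix.diagonal ![(1 : (w.1.adicCompletion L)), 1, ϖ])))
    (eA : (Gqs L v) ≃ₜ* ↥(unitaryGroupOfForm (galAdicCompletionMap (L := L) (IsCMField.complexConj L) hw) ((StdForm.antidiagonal 3).over (w.1.adicCompletion L))))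
    {a : (Gqs L v) →* ((latticeGraph (galAdicCompletionMap (L := L) (IsCMField.complexConj L) hw) ϖ ((StdForm.antidiagonal 3).over (w.1.adicCompletion L))) ≃g (latticeGraph (galAdicCompletionMap (L := L) (IsCMField.complexConj L) hw) ϖ ((StdForm.antidiagonal 3).over (w.1.adicCompletion L))))} (ha : ∀ g, a g = latticeGraphIso (galAdicCompletionMap (L := L) (IsCMField.complexConj L) hw) ϖ ((StdForm.antidiagonal 3).over (w.1.adicCompletion L)) (eA g))
    (htrE : ∀ d d' : (latticeGraph (galAdicCompletionMap (L := L) (IsCMField.complexConj L) hw) ϖ ((StdForm.antidiagonal 3).over (w.1.adicCompletion L))).edgeSet, ∃ g : (Gqs L v), (a g).mapEdgeSet d = d')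
    [MeasurableSpace (Gqs L v)] [BorelSpace (Gqs L v)]
    [∀ γ : (Gqs L v), MeasurableSpace ((Gqs L v) ⧸ Subgroup.centralizer ({γ} : Set (Gqs L v)))]
    [∀ γ : (Gqs L v), BorelSpace ((Gqs L v) ⧸ Subgroup.centralizer ({γ} : Set (Gqs L v)))]
    (νQv : Measure (Gqs L v)) [νQv.IsHaarMeasure] [νQv.IsMulRightInvariant]
    {mQv : OrbitalMeasureFamily (Gqs L v)} (hcanQ : mQv.IsCanonical (fun γ => IsRegularElt (γ.val : GL (Fin 3) (UnitaryGroup.LocalRing L v))) νQv)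
    (τ : Orientation (latticeGraph (galAdicCompletionMap (L := L) (IsCMField.complexConj L) hw) ϖ ((StdForm.antidiagonal 3).over (w.1.adicCompletion L)))) (hτ : ∀ d, τ.tail d < τ.head d)
    {e : ℕ} {U : {M : Submodule 𝒪[(w.1.adicCompletion L)] (Fin 3 → (w.1.adicCompletion L)) // IsVertex (galAdicCompletionMap (L := L) (IsCMField.complexConj L) hw) ϖ ((StdForm.antidiagonal 3).over (w.1.adicCompletion L)) M} → Subgroup (Gqs L v)}
    (hU : ∀ x g, g ∈ U x ↔ mapGL ((eA g : ↥(unitaryGroupOfForm (galAdicCompletionMap (L := L) (IsCMField.complexConj L) hw) ((StdForm.antidiagonal 3).over (w.1.adicCompletion L)))) : GL (Fin 3) (w.1.adicCompletion L)) x.1 = x.1 ∧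
      x.1.map ((Matrix.toLin' ((((eA g : ↥(unitaryGroupOfForm (galAdicCompletionMap (L := L) (IsCMField.complexConj L) hw) ((StdForm.antidiagonal 3).over (w.1.adicCompletion L)))) : GL (Fin 3) (w.1.adicCompletion L)) : Matrix (Fin 3) (Fin 3) (w.1.adicCompletion L)) - 1)).restrictScalars 𝒪[(w.1.adicCompletion L)]) ≤ scaleLattice (ϖ ^ (e + 1)) x.1)
    (hUo : ∀ x, IsOpen (U x : Set (Gqs L v))) (hUc : ∀ x, IsCompact (U x : Set (Gqs L v)))
    (hEo : ∀ d : (latticeGraph (galAdicCompletionMap (L := L) (IsCMField.complexConj L) hw) ϖ ((StdForm.antidiagonal 3).over (w.1.adicCompletion L))).edgeSet, IsOpen ((U (τ.head d) ⊔ U (τ.tail d) : Subgroup (Gqs L v)) : Set (Gqs L v)))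
    (hEc : ∀ d : (latticeGraph (galAdicCompletionMap (L := L) (IsCMField.complexConj L) hw) ϖ ((StdForm.antidiagonal 3).over (w.1.adicCompletion L))).edgeSet, IsCompact ((U (τ.head d) ⊔ U (τ.tail d) : Subgroup (Gqs L v)) : Set (Gqs L v)))
    (d₁ : (latticeGraph (galAdicCompletionMap (L := L) (IsCMField.complexConj L) hw) ϖ ((StdForm.antidiagonal 3).over (w.1.adicCompletion L))).edgeSet) (P₀ P₂ P₁ : Subgroup (Gqs L v))
    (hP₀ : ∀ g, g ∈ P₀ ↔ a g (τ.head d₁) = τ.head d₁) (hP₂ : ∀ g, g ∈ P₂ ↔ a g (τ.tail d₁) = τ.tail d₁) (hP₁ : ∀ g, g ∈ P₁ ↔ (a g).mapEdgeSet d₁ = d₁)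
    {V : Type*} [AddCommGroup V] [Module ℂ V] (ρ : Representation ℂ (Gqs L v) V)
    [FiniteDimensional ℂ ↥(ρ.fixedPoints (U (τ.head d₁)))] [FiniteDimensional ℂ ↥(ρ.fixedPoints (U (τ.tail d₁)))]
    [FiniteDimensional ℂ ↥(ρ.fixedPoints (U (τ.head d₁) ⊔ U (τ.tail d₁)))]
    (τ₀ : Representation ℂ ↥P₀ ↥(ρ.fixedPoints (U (τ.head d₁))))
    (hτρ₀ : ∀ (p : ↥P₀) (x : ↥(ρ.fixedPoints (U (τ.head d₁)))), ((τ₀ p x : ↥(ρ.fixedPoints (U (τ.head d₁)))) : V) = ρ (p : (Gqs L v)) (x : V))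
    (hτ₀ : ∀ p : ↥P₀, (p : (Gqs L v)) ∈ U (τ.head d₁) → τ₀ p = 1)
    (τ₂ : Representation ℂ ↥P₂ ↥(ρ.fixedPoints (U (τ.tail d₁))))
    (hτρ₂ : ∀ (p : ↥P₂) (x : ↥(ρ.fixedPoints (U (τ.tail d₁)))), ((τ₂ p x : ↥(ρ.fixedPoints (U (τ.tail d₁)))) : V) = ρ (p : (Gqs L v)) (x : V))
    (hτ₂ : ∀ p : ↥P₂, (p : (Gqs L v)) ∈ U (τ.tail d₁) → τ₂ p = 1)
    (τ₁ : Representation ℂ ↥P₁ ↥(ρ.fixedPoints (U (τ.head d₁) ⊔ U (τ.tail d₁))))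
    (hτρ₁ : ∀ (p : ↥P₁) (x : ↥(ρ.fixedPoints (U (τ.head d₁) ⊔ U (τ.tail d₁)))), ((τ₁ p x : ↥(ρ.fixedPoints (U (τ.head d₁) ⊔ U (τ.tail d₁)))) : V) = ρ (p : (Gqs L v)) (x : V))
    (hτ₁ : ∀ p : ↥P₁, (p : (Gqs L v)) ∈ U (τ.head d₁) ⊔ U (τ.tail d₁) → τ₁ p = 1)
    {f₀ f₂ f₁ : (Gqs L v) → ℂ}
    (hfP₀ : ∀ (g : (Gqs L v)) (hg : g ∈ P₀), f₀ g = Representation.character τ₀ ⟨g, hg⟩⁻¹) (hf0₀ : ∀ g ∉ P₀, f₀ g = 0)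
    (hfP₂ : ∀ (g : (Gqs L v)) (hg : g ∈ P₂), f₂ g = Representation.character τ₂ ⟨g, hg⟩⁻¹) (hf0₂ : ∀ g ∉ P₂, f₂ g = 0)
    (hfP₁ : ∀ (g : (Gqs L v)) (hg : g ∈ P₁), f₁ g = Representation.character τ₁ ⟨g, hg⟩⁻¹) (hf0₁ : ∀ g ∉ P₁, f₁ g = 0)
    {γ : (Gqs L v)} (hreg : IsRegularElt (γ.val : GL (Fin 3) (UnitaryGroup.LocalRing L v)))
    (hell : IsCompact ((Subgroup.centralizer ({γ} : Set (Gqs L v))) : Set (Gqs L v)))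
    (hfin : {x : {M : Submodule 𝒪[(w.1.adicCompletion L)] (Fin 3 → (w.1.adicCompletion L)) // IsVertex (galAdicCompletionMap (L := L) (IsCMField.complexConj L) hw) ϖ ((StdForm.antidiagonal 3).over (w.1.adicCompletion L)) M} | a γ x = x}.Finite) (hfinE : {d : (latticeGraph (galAdicCompletionMap (L := L) (IsCMField.complexConj L) hw) ϖ ((StdForm.antidiagonal 3).over (w.1.adicCompletion L))).edgeSet | (a γ).mapEdgeSet d = d}.Finite) :
    classOrbitalIntegral mQv
        ((((νQv.real (P₀ : Set (Gqs L v)))⁻¹ : ℂ)) • f₀ + (((νQv.real (P₂ : Set (Gqs L v)))⁻¹ : ℂ)) • f₂ - (((νQv.real (P₁ : Set (Gqs L v)))⁻¹ : ℂ)) • f₁) (ConjClasses.mk γ) =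
      (∑ x ∈ hfin.toFinset, ρ.levelTrace (hUo x) (hUc x) γ⁻¹) - ∑ d ∈ hfinE.toFinset, ρ.levelTrace (hEo d) (hEc d) γ⁻¹ := by
  classical
  have hHf : ((qsForm L).map (cmConjRingHom L))ᵀ = qsForm L := UnitaryGroup.antidiagOne_isHermitian L 3
  have hdetf : (qsForm L).det ≠ 0 := (UnitaryGroup.isUnit_antidiagOne_det L 3).ne_zero
  have hQ : ∀ g x : (Gqs L v), IsRegularElt (g.val : GL (Fin 3) (UnitaryGroup.LocalRing L v)) →
      IsRegularElt ((x * g * x⁻¹ : (Gqs L v)).val : GL (Fin 3) (UnitaryGroup.LocalRing L v)) := fun g x hg => UnitaryGroup.isRegularElt_val_conj L 3 (qsForm L) v g x hg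
  haveI : CompactSpace (Subgroup.centralizer ({γ} : Set (Gqs L v))) := isCompact_iff_compactSpace.1 hell
  have hO : IsClosed {x : (Gqs L v) | ∃ y : (Gqs L v), y * γ * y⁻¹ = x} := UnitaryGroup.isClosed_conjClass_local_of_isRegularElt L 3 (qsForm L) v hHf hdetf γ hreg
  have hne : ∀ P : Subgroup (Gqs L v), IsOpen (P : Set (Gqs L v)) → IsCompact (P : Set (Gqs L v)) → (νQv.real (P : Set (Gqs L v)) : ℂ) ≠ 0 := fun P hPo hPc => by
    rw [Ne, Complex.ofReal_eq_zero]
    exact (measureReal_pos_of_isCompact_isOpen νQv hPo hPc).ne'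
  have hJ : Valued.v (((StdForm.antidiagonal 3).over (w.1.adicCompletion L))).det = 1 := v_det_antidiagonal_three
  -- «a fixed edge has fixed ends» (no inversion)
  have hfixE : ∀ (g : (Gqs L v)) (d : (latticeGraph (galAdicCompletionMap (L := L) (IsCMField.complexConj L) hw) ϖ ((StdForm.antidiagonal 3).over (w.1.adicCompletion L))).edgeSet), (a g).mapEdgeSet d = d ↔ a g (τ.head d) = τ.head d ∧ a g (τ.tail d) = τ.tail d :=
    mapEdgeSet_eq_iff L v w hw eA ha τ hτ
  have hadj₁ : (latticeGraph (galAdicCompletionMap (L := L) (IsCMField.complexConj L) hw) ϖ ((StdForm.antidiagonal 3).over (w.1.adicCompletion L))).Adj (τ.head d₁) (τ.tail d₁) := τ.adj_head_tail d₁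
  -- «level ≥ 1 fixes the closed star», place-free (★ FILE P §6 through `eA`)
  have hUadj : ∀ {g : (Gqs L v)} {x y : {M : Submodule 𝒪[(w.1.adicCompletion L)] (Fin 3 → (w.1.adicCompletion L)) // IsVertex (galAdicCompletionMap (L := L) (IsCMField.complexConj L) hw) ϖ ((StdForm.antidiagonal 3).over (w.1.adicCompletion L)) M}},
      g ∈ U x → (latticeGraph (galAdicCompletionMap (L := L) (IsCMField.complexConj L) hw) ϖ ((StdForm.antidiagonal 3).over (w.1.adicCompletion L))).Adj x y → a g y = y := fun {g x y} hg hxy => by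
    rw [ha]
    exact latticeGraphIso_apply_eq_of_mem_unitaryLevel_of_adj_of_v (map_unitaryLevel_mem_iff hU) hvσ hϖ (Subgroup.mem_map_of_mem eA.toMonoidHom hg) hxy
  -- types of the ends of `d₁`; the three stabilisers are compact open; `Uᵢ ≤ Pᵢ`
  obtain ⟨k₀, hk₀⟩ := (τ.head d₁).2
  obtain ⟨k₂, hk₂⟩ := (τ.tail d₁).2
  obtain ⟨hk₂2, hk₀0⟩ := type_of_lt_three hvσ hϖ hJ hk₂ hk₀ (Subtype.coe_lt_coe.2 (hτ d₁))
  subst hk₂2 hk₀0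
  have hP₀o : IsOpen (P₀ : Set (Gqs L v)) := by rw [Set.ext hP₀]; exact isOpen_setOf_actionHom_apply_eq ha (τ.head d₁)
  have hP₀c : IsCompact (P₀ : Set (Gqs L v)) := by rw [Set.ext hP₀]; exact isCompact_setOf_actionHom_apply_eq L v w hw eA ha (τ.head d₁)
  have hP₂o : IsOpen (P₂ : Set (Gqs L v)) := by rw [Set.ext hP₂]; exact isOpen_setOf_actionHom_apply_eq ha (τ.tail d₁)
  have hP₂c : IsCompact (P₂ : Set (Gqs L v)) := by rw [Set.ext hP₂]; exact isCompact_setOf_actionHom_apply_eq L v w hw eA ha (τ.tail d₁)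
  have hUP₀ : U (τ.head d₁) ≤ P₀ := fun u hu => (hP₀ u).2 (actionHom_apply_eq_of_mem ha hU hu)
  have hUP₂ : U (τ.tail d₁) ≤ P₂ := fun u hu => (hP₂ u).2 (actionHom_apply_eq_of_mem ha hU hu)
  have hUP₁ : U (τ.head d₁) ⊔ U (τ.tail d₁) ≤ P₁ :=
    sup_le (fun u hu => (hP₁ u).2 ((hfixE u d₁).2 ⟨actionHom_apply_eq_of_mem ha hU hu, hUadj hu hadj₁⟩))
      (fun u hu => (hP₁ u).2 ((hfixE u d₁).2 ⟨hUadj hu hadj₁.symm, actionHom_apply_eq_of_mem ha hU hu⟩))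
  have hP₁P₀ : (P₁ : Set (Gqs L v)) ⊆ (P₀ : Set (Gqs L v)) := fun g hg => (hP₀ g).2 ((hfixE g d₁).1 ((hP₁ g).1 hg)).1
  have hP₁o : IsOpen (P₁ : Set (Gqs L v)) := Subgroup.isOpen_mono hUP₁ (hEo d₁)
  have hP₁c : IsCompact (P₁ : Set (Gqs L v)) := hP₀c.of_isClosed_subset (Subgroup.isClosed_of_isOpen P₁ hP₁o) hP₁P₀
  -- the three orbit terms (FILE 1-RAM §1 + ★ 48 FILE 1's place-free vertex unfolding)
  have h₀ := classOrbitalIntegral_kType_vertex_eq L v w hw eA ha νQv hcanQ hU hUo hUc (exists_actionHom_apply_eq_of_isVertexLattice_zero_of_involution L v w hw eA ha htr₀)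
    (τ.head d₁) hk₀ P₀ hP₀ ρ τ₀ hτρ₀ hτ₀ hfP₀ hf0₀ hreg hell
  have h₂ := classOrbitalIntegral_kType_vertex_eq L v w hw eA ha νQv hcanQ hU hUo hUc (exists_actionHom_apply_eq_of_isVertexLattice_two_of_involution L v w hw eA ha htr₂)
    (τ.tail d₁) hk₂ P₂ hP₂ ρ τ₂ hτρ₂ hτ₂ hfP₂ hf0₂ hreg hell
  have h₁ := classOrbitalIntegral_kType_edge_eq_of_involution L v w hw hvσ hϖ eA ha νQv hcanQ τ hτ htrE hU hEo hEc d₁ P₁ hP₁ ρ τ₁ hτρ₁ hτ₁ hfP₁ hf0₁ hreg hell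
  -- additivity (★ R48-gen FILE 2 §2, family indexed by `Fin 3`)
  have hsum := classOrbitalIntegral_finset_sum_smul_of_isClosed hQ hcanQ hreg hO Finset.univ
    ![((νQv.real (P₀ : Set (Gqs L v)))⁻¹ : ℂ), ((νQv.real (P₂ : Set (Gqs L v)))⁻¹ : ℂ), -((νQv.real (P₁ : Set (Gqs L v)))⁻¹ : ℂ)] ![f₀, f₂, f₁]
    (fun i _ => by
      fin_cases i
      · exact Representation.continuous_of_kType (hUo (τ.head d₁)) hUP₀ τ₀ (fun u hu => hτ₀ ⟨u, hUP₀ hu⟩ hu) hfP₀ hf0₀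
      · exact Representation.continuous_of_kType (hUo (τ.tail d₁)) hUP₂ τ₂ (fun u hu => hτ₂ ⟨u, hUP₂ hu⟩ hu) hfP₂ hf0₂
      · exact Representation.continuous_of_kType (hEo d₁) hUP₁ τ₁ (fun u hu => hτ₁ ⟨u, hUP₁ hu⟩ hu) hfP₁ hf0₁)
    (fun i _ => by
      fin_cases i
      · exact HasCompactSupport.of_support_subset_isCompact hP₀c (Representation.support_kType_subset hf0₀)
      · exact HasCompactSupport.of_support_subset_isCompact hP₂c (Representation.support_kType_subset hf0₂)
      · exact HasCompactSupport.of_support_subset_isCompact hP₁c (Representation.support_kType_subset hf0₁))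
  have hEP : (((νQv.real (P₀ : Set (Gqs L v)))⁻¹ : ℂ)) • f₀ + (((νQv.real (P₂ : Set (Gqs L v)))⁻¹ : ℂ)) • f₂ - (((νQv.real (P₁ : Set (Gqs L v)))⁻¹ : ℂ)) • f₁ =
      ∑ i : Fin 3, (![((νQv.real (P₀ : Set (Gqs L v)))⁻¹ : ℂ), ((νQv.real (P₂ : Set (Gqs L v)))⁻¹ : ℂ), -((νQv.real (P₁ : Set (Gqs L v)))⁻¹ : ℂ)] i) • (![f₀, f₂, f₁] i) := by
    rw [Fin.sum_univ_three]
    simp only [Matrix.cons_val_zero, Matrix.cons_val_one, Matrix.cons_val_two, Matrix.head_cons, Matrix.tail_cons, neg_smul, sub_eq_add_neg]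
  -- regrouping: `X^γ⁰ = X^γ⁰_{self-dual} ⊔ X^γ⁰_{type two}`
  have hcover : {x : {M : Submodule 𝒪[(w.1.adicCompletion L)] (Fin 3 → (w.1.adicCompletion L)) // IsVertex (galAdicCompletionMap (L := L) (IsCMField.complexConj L) hw) ϖ ((StdForm.antidiagonal 3).over (w.1.adicCompletion L)) M} | a γ x = x ∧ IsVertexLattice (galAdicCompletionMap (L := L) (IsCMField.complexConj L) hw) ϖ ((StdForm.antidiagonal 3).over (w.1.adicCompletion L)) 0 x.1} ∪ {x : {M : Submodule 𝒪[(w.1.adicCompletion L)] (Fin 3 → (w.1.adicCompletion L)) // IsVertex (galAdicCompletionMap (L := L) (IsCMField.complexConj L) hw) ϖ ((StdForm.antidiagonal 3).over (w.1.adicCompletion L)) M} | a γ x = x ∧ IsVertexLattice (galAdicCompletionMap (L := L) (IsCMField.complexConj L) hw) ϖ ((StdForm.antidiagonal 3).over (w.1.adicCompletion L)) 2 x.1} =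
      {x : {M : Submodule 𝒪[(w.1.adicCompletion L)] (Fin 3 → (w.1.adicCompletion L)) // IsVertex (galAdicCompletionMap (L := L) (IsCMField.complexConj L) hw) ϖ ((StdForm.antidiagonal 3).over (w.1.adicCompletion L)) M} | a γ x = x} := by
    ext x
    simp only [Set.mem_union, Set.mem_setOf_eq]
    constructor
    · rintro (h | h) <;> exact h.1
    · intro h
      obtain ⟨k, hk⟩ := x.2
      rcases type_eq_zero_or_two_of_isVertexLattice_three hvσ hϖ hJ hk with rfl | rfl
      · exact Or.inl ⟨h, hk⟩
      · exact Or.inr ⟨h, hk⟩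
  have hdisj : Disjoint {x : {M : Submodule 𝒪[(w.1.adicCompletion L)] (Fin 3 → (w.1.adicCompletion L)) // IsVertex (galAdicCompletionMap (L := L) (IsCMField.complexConj L) hw) ϖ ((StdForm.antidiagonal 3).over (w.1.adicCompletion L)) M} | a γ x = x ∧ IsVertexLattice (galAdicCompletionMap (L := L) (IsCMField.complexConj L) hw) ϖ ((StdForm.antidiagonal 3).over (w.1.adicCompletion L)) 0 x.1} {x : {M : Submodule 𝒪[(w.1.adicCompletion L)] (Fin 3 → (w.1.adicCompletion L)) // IsVertex (galAdicCompletionMap (L := L) (IsCMField.complexConj L) hw) ϖ ((StdForm.antidiagonal 3).over (w.1.adicCompletion L)) M} | a γ x = x ∧ IsVertexLattice (galAdicCompletionMap (L := L) (IsCMField.complexConj L) hw) ϖ ((StdForm.antidiagonal 3).over (w.1.adicCompletion L)) 2 x.1} :=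
    Set.disjoint_left.2 fun x h0 h2 => not_isSelfDualLattice_of_isVertexLattice_two_of_v hvσ hϖ h2.2 h0.2
  have hvert : (∑ᶠ x ∈ {x : {M : Submodule 𝒪[(w.1.adicCompletion L)] (Fin 3 → (w.1.adicCompletion L)) // IsVertex (galAdicCompletionMap (L := L) (IsCMField.complexConj L) hw) ϖ ((StdForm.antidiagonal 3).over (w.1.adicCompletion L)) M} | a γ x = x ∧ IsVertexLattice (galAdicCompletionMap (L := L) (IsCMField.complexConj L) hw) ϖ ((StdForm.antidiagonal 3).over (w.1.adicCompletion L)) 0 x.1}, ρ.levelTrace (hUo x) (hUc x) γ⁻¹) +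
      ∑ᶠ x ∈ {x : {M : Submodule 𝒪[(w.1.adicCompletion L)] (Fin 3 → (w.1.adicCompletion L)) // IsVertex (galAdicCompletionMap (L := L) (IsCMField.complexConj L) hw) ϖ ((StdForm.antidiagonal 3).over (w.1.adicCompletion L)) M} | a γ x = x ∧ IsVertexLattice (galAdicCompletionMap (L := L) (IsCMField.complexConj L) hw) ϖ ((StdForm.antidiagonal 3).over (w.1.adicCompletion L)) 2 x.1}, ρ.levelTrace (hUo x) (hUc x) γ⁻¹ =
        ∑ x ∈ hfin.toFinset, ρ.levelTrace (hUo x) (hUc x) γ⁻¹ := by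
    rw [← finsum_mem_union hdisj (hfin.subset fun x hx => hx.1) (hfin.subset fun x hx => hx.1), hcover, finsum_mem_eq_finite_toFinset_sum _ hfin]
  have hedge : ∑ᶠ d ∈ {d : (latticeGraph (galAdicCompletionMap (L := L) (IsCMField.complexConj L) hw) ϖ ((StdForm.antidiagonal 3).over (w.1.adicCompletion L))).edgeSet | (a γ).mapEdgeSet d = d}, ρ.levelTrace (hEo d) (hEc d) γ⁻¹ = ∑ d ∈ hfinE.toFinset, ρ.levelTrace (hEo d) (hEc d) γ⁻¹ :=
    finsum_mem_eq_finite_toFinset_sum _ hfinE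
  rw [← hEP, Fin.sum_univ_three] at hsum
  simp only [Matrix.cons_val_zero, Matrix.cons_val_one, Matrix.cons_val_two, Matrix.head_cons, Matrix.tail_cons] at hsum
  rw [hsum]
  exact epSum_arith (hne P₀ hP₀o hP₀c) (hne P₂ hP₂o hP₂c) (hne P₁ hP₁o hP₁c) h₀ h₂ h₁ hvert hedge

/-- **(SS-O) AT THE DATUM AT A TAME RAMIFIED PLACE** (`σ ϖ = −ϖ`, `|2| = 1`): ★ 48 FILE 2's HEAD with `hd` replaced by the seven tame letters `hσ hvσ hϖ hσϖ hres h2 hnorm` of ★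
`isTree_latticeGraph_three_of_neg` — `htr₀` by ★ `exists_unitary_mapGL_stdLattice_eq_of_isSelfDualLattice_of_v_two`, `htr₂` by ★ `forall_isVertexLattice_two_exists_mapGL_N₁_eq_of_neg`, `htrE` by
FILE 1-RAM `exists_mapEdgeSet_eq_of_v_two`; every other binder and the conclusion VERBATIM.  (The tame suppliers of `hell hfin hfinE` are consumer-side: ★
`isCompact_centralizer_of_not_mem_hyperbolicSet`, ★ B3(53) `ellipticFixedTree_of_mem_ellG_of_neg`.) [cite: SchneiderStuhler1997, §III.4] [cite: Kottwitz1988, §2 Theorem 2]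
[cite: Rogawski1990, §4.9 p. 54; §12.5 pp. 182–187] [cite: BruhatTits1972, §10] -/
theorem classOrbitalIntegral_epSum_eq_fixedVertexSum_sub_fixedEdgeSum_of_neg
    (w : PlacesOver L v) (hw : IsCMField.complexConj L • w.1 = w.1) {ϖ : (w.1.adicCompletion L)}
    (hσ : ∀ x, (galAdicCompletionMap (L := L) (IsCMField.complexConj L) hw) ((galAdicCompletionMap (L := L) (IsCMField.complexConj L) hw) x) = x) (hvσ : ∀ x, Valued.v ((galAdicCompletionMap (L := L) (IsCMField.complexConj L) hw) x) = Valued.v x) (hϖ : Valued.v ϖ = WithZero.exp (-1 : ℤ))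
    (hσϖ : (galAdicCompletionMap (L := L) (IsCMField.complexConj L) hw) ϖ = -ϖ) (hres : ∀ x : (w.1.adicCompletion L), Valued.v x ≤ 1 → Valued.v ((galAdicCompletionMap (L := L) (IsCMField.complexConj L) hw) x - x) < 1) (h2 : Valued.v (2 : (w.1.adicCompletion L)) = 1) (hnorm : ∀ u : (w.1.adicCompletion L), (galAdicCompletionMap (L := L) (IsCMField.complexConj L) hw) u = u → Valued.v (u - 1) < 1 → ∃ z : (w.1.adicCompletion L), z * (galAdicCompletionMap (L := L) (IsCMField.complexConj L) hw) z = u ∧ Valued.v (z - 1) ≤ Valued.v (u - 1))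
    (eA : (Gqs L v) ≃ₜ* ↥(unitaryGroupOfForm (galAdicCompletionMap (L := L) (IsCMField.complexConj L) hw) ((StdForm.antidiagonal 3).over (w.1.adicCompletion L))))
    {a : (Gqs L v) →* ((latticeGraph (galAdicCompletionMap (L := L) (IsCMField.complexConj L) hw) ϖ ((StdForm.antidiagonal 3).over (w.1.adicCompletion L))) ≃g (latticeGraph (galAdicCompletionMap (L := L) (IsCMField.complexConj L) hw) ϖ ((StdForm.antidiagonal 3).over (w.1.adicCompletion L))))} (ha : ∀ g, a g = latticeGraphIso (galAdicCompletionMap (L := L) (IsCMField.complexConj L) hw) ϖ ((StdForm.antidiagonal 3).over (w.1.adicCompletion L)) (eA g))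
    [MeasurableSpace (Gqs L v)] [BorelSpace (Gqs L v)]
    [∀ γ : (Gqs L v), MeasurableSpace ((Gqs L v) ⧸ Subgroup.centralizer ({γ} : Set (Gqs L v)))]
    [∀ γ : (Gqs L v), BorelSpace ((Gqs L v) ⧸ Subgroup.centralizer ({γ} : Set (Gqs L v)))]
    (νQv : Measure (Gqs L v)) [νQv.IsHaarMeasure] [νQv.IsMulRightInvariant]
    {mQv : OrbitalMeasureFamily (Gqs L v)} (hcanQ : mQv.IsCanonical (fun γ => IsRegularElt (γ.val : GL (Fin 3) (UnitaryGroup.LocalRing L v))) νQv)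
    (τ : Orientation (latticeGraph (galAdicCompletionMap (L := L) (IsCMField.complexConj L) hw) ϖ ((StdForm.antidiagonal 3).over (w.1.adicCompletion L)))) (hτ : ∀ d, τ.tail d < τ.head d)
    {e : ℕ} {U : {M : Submodule 𝒪[(w.1.adicCompletion L)] (Fin 3 → (w.1.adicCompletion L)) // IsVertex (galAdicCompletionMap (L := L) (IsCMField.complexConj L) hw) ϖ ((StdForm.antidiagonal 3).over (w.1.adicCompletion L)) M} → Subgroup (Gqs L v)}
    (hU : ∀ x g, g ∈ U x ↔ mapGL ((eA g : ↥(unitaryGroupOfForm (galAdicCompletionMap (L := L) (IsCMField.complexConj L) hw) ((StdForm.antidiagonal 3).over (w.1.adicCompletion L)))) : GL (Fin 3) (w.1.adicCompletion L)) x.1 = x.1 ∧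
      x.1.map ((Matrix.toLin' ((((eA g : ↥(unitaryGroupOfForm (galAdicCompletionMap (L := L) (IsCMField.complexConj L) hw) ((StdForm.antidiagonal 3).over (w.1.adicCompletion L)))) : GL (Fin 3) (w.1.adicCompletion L)) : Matrix (Fin 3) (Fin 3) (w.1.adicCompletion L)) - 1)).restrictScalars 𝒪[(w.1.adicCompletion L)]) ≤ scaleLattice (ϖ ^ (e + 1)) x.1)
    (hUo : ∀ x, IsOpen (U x : Set (Gqs L v))) (hUc : ∀ x, IsCompact (U x : Set (Gqs L v)))
    (hEo : ∀ d : (latticeGraph (galAdicCompletionMap (L := L) (IsCMField.complexConj L) hw) ϖ ((StdForm.antidiagonal 3).over (w.1.adicCompletion L))).edgeSet, IsOpen ((U (τ.head d) ⊔ U (τ.tail d) : Subgroup (Gqs L v)) : Set (Gqs L v)))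
    (hEc : ∀ d : (latticeGraph (galAdicCompletionMap (L := L) (IsCMField.complexConj L) hw) ϖ ((StdForm.antidiagonal 3).over (w.1.adicCompletion L))).edgeSet, IsCompact ((U (τ.head d) ⊔ U (τ.tail d) : Subgroup (Gqs L v)) : Set (Gqs L v)))
    (d₁ : (latticeGraph (galAdicCompletionMap (L := L) (IsCMField.complexConj L) hw) ϖ ((StdForm.antidiagonal 3).over (w.1.adicCompletion L))).edgeSet) (P₀ P₂ P₁ : Subgroup (Gqs L v))
    (hP₀ : ∀ g, g ∈ P₀ ↔ a g (τ.head d₁) = τ.head d₁) (hP₂ : ∀ g, g ∈ P₂ ↔ a g (τ.tail d₁) = τ.tail d₁) (hP₁ : ∀ g, g ∈ P₁ ↔ (a g).mapEdgeSet d₁ = d₁)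
    {V : Type*} [AddCommGroup V] [Module ℂ V] (ρ : Representation ℂ (Gqs L v) V)
    [FiniteDimensional ℂ ↥(ρ.fixedPoints (U (τ.head d₁)))] [FiniteDimensional ℂ ↥(ρ.fixedPoints (U (τ.tail d₁)))]
    [FiniteDimensional ℂ ↥(ρ.fixedPoints (U (τ.head d₁) ⊔ U (τ.tail d₁)))]
    (τ₀ : Representation ℂ ↥P₀ ↥(ρ.fixedPoints (U (τ.head d₁))))
    (hτρ₀ : ∀ (p : ↥P₀) (x : ↥(ρ.fixedPoints (U (τ.head d₁)))), ((τ₀ p x : ↥(ρ.fixedPoints (U (τ.head d₁)))) : V) = ρ (p : (Gqs L v)) (x : V))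
    (hτ₀ : ∀ p : ↥P₀, (p : (Gqs L v)) ∈ U (τ.head d₁) → τ₀ p = 1)
    (τ₂ : Representation ℂ ↥P₂ ↥(ρ.fixedPoints (U (τ.tail d₁))))
    (hτρ₂ : ∀ (p : ↥P₂) (x : ↥(ρ.fixedPoints (U (τ.tail d₁)))), ((τ₂ p x : ↥(ρ.fixedPoints (U (τ.tail d₁)))) : V) = ρ (p : (Gqs L v)) (x : V))
    (hτ₂ : ∀ p : ↥P₂, (p : (Gqs L v)) ∈ U (τ.tail d₁) → τ₂ p = 1)
    (τ₁ : Representation ℂ ↥P₁ ↥(ρ.fixedPoints (U (τ.head d₁) ⊔ U (τ.tail d₁))))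
    (hτρ₁ : ∀ (p : ↥P₁) (x : ↥(ρ.fixedPoints (U (τ.head d₁) ⊔ U (τ.tail d₁)))), ((τ₁ p x : ↥(ρ.fixedPoints (U (τ.head d₁) ⊔ U (τ.tail d₁)))) : V) = ρ (p : (Gqs L v)) (x : V))
    (hτ₁ : ∀ p : ↥P₁, (p : (Gqs L v)) ∈ U (τ.head d₁) ⊔ U (τ.tail d₁) → τ₁ p = 1)
    {f₀ f₂ f₁ : (Gqs L v) → ℂ}
    (hfP₀ : ∀ (g : (Gqs L v)) (hg : g ∈ P₀), f₀ g = Representation.character τ₀ ⟨g, hg⟩⁻¹) (hf0₀ : ∀ g ∉ P₀, f₀ g = 0)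
    (hfP₂ : ∀ (g : (Gqs L v)) (hg : g ∈ P₂), f₂ g = Representation.character τ₂ ⟨g, hg⟩⁻¹) (hf0₂ : ∀ g ∉ P₂, f₂ g = 0)
    (hfP₁ : ∀ (g : (Gqs L v)) (hg : g ∈ P₁), f₁ g = Representation.character τ₁ ⟨g, hg⟩⁻¹) (hf0₁ : ∀ g ∉ P₁, f₁ g = 0)
    {γ : (Gqs L v)} (hreg : IsRegularElt (γ.val : GL (Fin 3) (UnitaryGroup.LocalRing L v)))
    (hell : IsCompact ((Subgroup.centralizer ({γ} : Set (Gqs L v))) : Set (Gqs L v)))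
    (hfin : {x : {M : Submodule 𝒪[(w.1.adicCompletion L)] (Fin 3 → (w.1.adicCompletion L)) // IsVertex (galAdicCompletionMap (L := L) (IsCMField.complexConj L) hw) ϖ ((StdForm.antidiagonal 3).over (w.1.adicCompletion L)) M} | a γ x = x}.Finite) (hfinE : {d : (latticeGraph (galAdicCompletionMap (L := L) (IsCMField.complexConj L) hw) ϖ ((StdForm.antidiagonal 3).over (w.1.adicCompletion L))).edgeSet | (a γ).mapEdgeSet d = d}.Finite) :
    classOrbitalIntegral mQv
        ((((νQv.real (P₀ : Set (Gqs L v)))⁻¹ : ℂ)) • f₀ + (((νQv.real (P₂ : Set (Gqs L v)))⁻¹ : ℂ)) • f₂ - (((νQv.real (P₁ : Set (Gqs L v)))⁻¹ : ℂ)) • f₁) (ConjClasses.mk γ) =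
      (∑ x ∈ hfin.toFinset, ρ.levelTrace (hUo x) (hUc x) γ⁻¹) - ∑ d ∈ hfinE.toFinset, ρ.levelTrace (hEo d) (hEc d) γ⁻¹ :=
  classOrbitalIntegral_epSum_eq_fixedVertexSum_sub_fixedEdgeSum_of_involution L v w hw hvσ hϖ
    (fun _ hM => exists_unitary_mapGL_stdLattice_eq_of_isSelfDualLattice_of_v_two hσ hvσ hϖ h2 hM)
    (forall_isVertexLattice_two_exists_mapGL_N₁_eq_of_neg hσ hvσ hϖ hσϖ hres h2 hnorm) eA ha
    (exists_mapEdgeSet_eq_of_v_two L v w hw hσ hvσ hϖ h2 eA ha τ hτ) νQv hcanQ τ hτ hU hUo hUc hEo hEc d₁ P₀ P₂ P₁ hP₀ hP₂ hP₁ ρ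
    τ₀ hτρ₀ hτ₀ τ₂ hτρ₂ hτ₂ τ₁ hτρ₁ hτ₁ hfP₀ hf0₀ hfP₂ hf0₂ hfP₁ hf0₁ hreg hell hfin hfinE

end Head

end Summit.HodgeConjecture.HodgeConjecture.Cruxes.H413.F0P3cStCharTSEPFunctionOrbitalEllipticRamified

end
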